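import Literature.NumberTheory.Transcendental.KZCalculusProofs
import Literature.NumberTheory.Transcendental.KZLogCalculusProofs
import Literature.NumberTheory.Transcendental.KZGroundingRelations
import Literature.NumberTheory.Transcendental.KZVolumeConjectureProofs
import Literature.NumberTheory.Transcendental.KZMonomialCompression
import Literature.NumberTheory.Transcendental.KZSubcalculusInvariants
import Literature.NumberTheory.Transcendental.KZRelationsLE
import Summits.KontsevichZagierPeriods.KontsevichZagierPeriods.Theorems.UnfoldedStokesStokesGenerationStubSpanToReps
import Summits.KontsevichZagierPeriods.KontsevichZagierPeriods.Theorems.UnfoldedStokesStokesGenerationLineReduction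

/-!
# `StokesGeneration` (stmt-KontsevichZagierPeriods-3586) — line `fibrewise_stokes`, stub `stub_cubifyKernel`

Registered stub S1 of the line `fibrewise_stokes` of the crux `StokesGeneration` (route
UnfoldedStokes): **the one-cube normal form of the Kontsevich–Zagier calculus, resolution-free.**
Every formal `ℤ`-combination `x` of integral representations is, modulo the moves of the calculus
(`KZ.relations`: domain additivity (1a), integrand additivity (1b), change of variables (2),
Newton–Leibniz (3) [Kontsevich–Zagier 2001, §1.2]), ONE representation on the closed unit cube
`[0,1]^M = Set.pi univ (fun _ => Icc 0 1)` of some dimension `M`, with BOUNDED integrand.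

Proof. The set of `x` having such a normal form contains `0` (the zero integrand on `[0,1]⁰`), is
stable under negation (`[□, f] ↦ [□, −f]`, rule (1b)) and under sums (lift both cube
representations to a common dimension by Newton–Leibniz slabs `[□ᴺ, f] ∼ [□ᴺ⁺¹, f ∘ init]`, rule (3),
then add the integrands, rule (1b)), and is invariant under `relations`. By induction over the free
abelian group it remains to treat one representation `r`; by Viu-Sos' reduction in the tree
(`KZ.exists_sub_isBounded`, [Viu-Sos 2021, Thm. 1.1] without compactification) `[r] ≡ [A] − [B]`
with `A`, `B` BOUNDED volumes (integrand `1`), so it remains to treat a bounded volume `V ⊆ [−N, N]^d`: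
the affine contraction `Φ(z) = z/(4N) + 1/2` (rule (2), constant Jacobian `(4N)^{-d}`) carries `[V]`
to `[Φ(V), (4N)^d]` with `Φ(V) ⊆ [1/4, 3/4]^d`, and extension by zero to the closed cube is one
domain-additivity move plus the discarding of a representation with zero integrand. No resolution
of singularities and no Nash regularity is used.

The lifting of cube representations to a common dimension and the `ℚ`-semialgebraicity of the
closed cube are the landed `StokesGenerationLine.exists_liftCube` (`…LineReduction.lean`) and
`StokesGenerationLine.isSemialgebraic_cubePi` (`…StubSpanToReps.lean`).

References: M. Kontsevich, D. Zagier, *Periods* (2001), §1.2; J. Viu-Sos, *A semi-canonical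
reduction for periods of Kontsevich–Zagier*, IJNT 17 (2021), Thm. 1.1.
-/

noncomputable section

-- `Summit.KontsevichZagierPeriods.KontsevichZagierPeriods.…` is the tree's mandated layout (single-conjunct summit).
set_option linter.dupNamespace false

namespace Summit.KontsevichZagierPeriods.KontsevichZagierPeriods.Cruxes.StokesGeneration.FibrewiseStokes

open MeasureTheory Set
open Literature.NumberTheory.Transcendental
open Literature.NumberTheory.Transcendental.KZ
open Literature.ModelTheory.ExponentialFields (IsSemialgebraic)
open MvPolynomial (aeval X C)
open Summit.KontsevichZagierPeriods.KontsevichZagierPeriods.StokesGenerationLine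
  (isSemialgebraic_cubePi exists_liftCube)

/-! ## Closure properties of the one-cube normal form -/

/-- The one-cube normal form is invariant under the moves: if `x ≡ y` and `y` has a bounded cube
normal form then so does `x`. [folklore] -/
theorem cubify_of_sub_mem {x y : FormalRep} (hxy : x - y ∈ relations)
    (hy : ∃ (M : ℕ) (t : IntegralRep M),
      t.domain = Set.pi Set.univ (fun _ : Fin M => Set.Icc (0:ℝ) 1) ∧
      (∃ B : ℝ, ∀ z ∈ t.domain, |t.integrand z| ≤ B) ∧ y - of t ∈ relations) :
    ∃ (M : ℕ) (t : IntegralRep M),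
      t.domain = Set.pi Set.univ (fun _ : Fin M => Set.Icc (0:ℝ) 1) ∧
      (∃ B : ℝ, ∀ z ∈ t.domain, |t.integrand z| ≤ B) ∧ x - of t ∈ relations := by
  obtain ⟨M, t, htd, hB, hy⟩ := hy
  refine ⟨M, t, htd, hB, ?_⟩
  have : x - of t = (x - y) + (y - of t) := by abel
  rw [this]
  exact relations.add_mem hxy hy

/-- `0` has a bounded cube normal form: the zero integrand on the point `[0,1]⁰`, a relation
(rule (1b)). [folklore] -/
theorem cubify_zero :
    ∃ (M : ℕ) (t : IntegralRep M),
      t.domain = Set.pi Set.univ (fun _ : Fin M => Set.Icc (0:ℝ) 1) ∧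
      (∃ B : ℝ, ∀ z ∈ t.domain, |t.integrand z| ≤ B) ∧ (0 : FormalRep) - of t ∈ relations := by
  obtain ⟨z, hzd, hzi⟩ := exists_zeroRep (isSemialgebraic_cubePi 0)
  refine ⟨0, z, hzd, ⟨0, fun x _ => by simp [hzi]⟩, ?_⟩
  rw [zero_sub]
  exact relations.neg_mem (of_mem_relations_of_eqOn_zero z fun x _ => by simp [hzi])

/-- Negation preserves the bounded cube normal form: `−[□, f] ≡ [□, −f]` (rule (1b)).
[cite: KontsevichZagier2001, §1.2 rule (1)] -/
theorem cubify_neg {x : FormalRep}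
    (hx : ∃ (M : ℕ) (t : IntegralRep M),
      t.domain = Set.pi Set.univ (fun _ : Fin M => Set.Icc (0:ℝ) 1) ∧
      (∃ B : ℝ, ∀ z ∈ t.domain, |t.integrand z| ≤ B) ∧ x - of t ∈ relations) :
    ∃ (M : ℕ) (t : IntegralRep M),
      t.domain = Set.pi Set.univ (fun _ : Fin M => Set.Icc (0:ℝ) 1) ∧
      (∃ B : ℝ, ∀ z ∈ t.domain, |t.integrand z| ≤ B) ∧ -x - of t ∈ relations := by
  obtain ⟨M, t, htd, ⟨B, hB⟩, hx⟩ := hx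
  refine ⟨M, t.neg, htd, ⟨B, fun z hz => ?_⟩, ?_⟩
  · rw [IntegralRep.integrand_neg, Pi.neg_apply, abs_neg]
    exact hB z hz
  · have h : of t + of t.neg ∈ relations :=
      of_add_of_mem_relations_of_eqOn_neg rfl fun _ _ => rfl
    have e : -x - of t.neg = -(x - of t) - (of t + of t.neg) := by abel
    rw [e]
    exact relations.sub_mem (relations.neg_mem hx) h

/-- Sums preserve the bounded cube normal form: lift both cube representations to a common
dimension by slabs (rule (3)) and add the integrands (rule (1b)); the bound is the sum of the
bounds. [cite: KontsevichZagier2001, §1.2 rule (1)] -/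
theorem cubify_add {x y : FormalRep}
    (hx : ∃ (M : ℕ) (t : IntegralRep M),
      t.domain = Set.pi Set.univ (fun _ : Fin M => Set.Icc (0:ℝ) 1) ∧
      (∃ B : ℝ, ∀ z ∈ t.domain, |t.integrand z| ≤ B) ∧ x - of t ∈ relations)
    (hy : ∃ (M : ℕ) (t : IntegralRep M),
      t.domain = Set.pi Set.univ (fun _ : Fin M => Set.Icc (0:ℝ) 1) ∧
      (∃ B : ℝ, ∀ z ∈ t.domain, |t.integrand z| ≤ B) ∧ y - of t ∈ relations) :
    ∃ (M : ℕ) (t : IntegralRep M),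
      t.domain = Set.pi Set.univ (fun _ : Fin M => Set.Icc (0:ℝ) 1) ∧
      (∃ B : ℝ, ∀ z ∈ t.domain, |t.integrand z| ≤ B) ∧ x + y - of t ∈ relations := by
  obtain ⟨M₁, t₁, ht₁d, ⟨B₁, hB₁⟩, hx⟩ := hx
  obtain ⟨M₂, t₂, ht₂d, ⟨B₂, hB₂⟩, hy⟩ := hy
  obtain ⟨u₁, hu₁d, hu₁i, hu₁r⟩ := exists_liftCube M₁ (max M₁ M₂) (le_max_left _ _) t₁ ht₁d
  obtain ⟨u₂, hu₂d, hu₂i, hu₂r⟩ := exists_liftCube M₂ (max M₁ M₂) (le_max_right _ _) t₂ ht₂d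
  have hs₁ : IsSemialgebraicFunOn ℚ (Set.pi Set.univ (fun _ : Fin (max M₁ M₂) => Set.Icc (0:ℝ) 1))
      u₁.integrand := hu₁d ▸ u₁.isSemialgebraicFunOn_integrand
  have hs₂ : IsSemialgebraicFunOn ℚ (Set.pi Set.univ (fun _ : Fin (max M₁ M₂) => Set.Icc (0:ℝ) 1))
      u₂.integrand := hu₂d ▸ u₂.isSemialgebraicFunOn_integrand
  have hi₁ : IntegrableOn u₁.integrand (Set.pi Set.univ (fun _ : Fin (max M₁ M₂) => Set.Icc (0:ℝ) 1)) :=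
    hu₁d ▸ u₁.integrableOn
  have hi₂ : IntegrableOn u₂.integrand (Set.pi Set.univ (fun _ : Fin (max M₁ M₂) => Set.Icc (0:ℝ) 1)) :=
    hu₂d ▸ u₂.integrableOn
  -- the sum representation on the common cube
  let t : IntegralRep (max M₁ M₂) :=
    { domain := Set.pi Set.univ (fun _ : Fin (max M₁ M₂) => Set.Icc (0:ℝ) 1)
      integrand := u₁.integrand + u₂.integrand
      isSemialgebraic_domain := isSemialgebraic_cubePi _
      isSemialgebraicFunOn_integrand := IsSemialgebraicFunOn.add_holds hs₁ hs₂
      integrableOn := hi₁.add hi₂ }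
  have hadd : of t - of u₁ - of u₂ ∈ relations :=
    integrandAddRel_subset_relations ⟨_, t, u₁, u₂, hu₁d, hu₂d, fun _ _ => rfl, rfl⟩
  refine ⟨max M₁ M₂, t, rfl, ⟨B₁ + B₂, fun z hz => ?_⟩, ?_⟩
  · show |u₁.integrand z + u₂.integrand z| ≤ B₁ + B₂
    have hz' : z ∈ Set.pi Set.univ (fun _ : Fin (max M₁ M₂) => Set.Icc (0:ℝ) 1) := hz
    have h1 : |u₁.integrand z| ≤ B₁ := by
      rw [hu₁i z hz']
      exact hB₁ _ (by rw [ht₁d]; exact fun l _ => hz' (Fin.castLE _ l) (mem_univ _))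
    have h2 : |u₂.integrand z| ≤ B₂ := by
      rw [hu₂i z hz']
      exact hB₂ _ (by rw [ht₂d]; exact fun l _ => hz' (Fin.castLE _ l) (mem_univ _))
    exact (abs_add_le _ _).trans (add_le_add h1 h2)
  · have e : x + y - of t = (x - of t₁) + (y - of t₂) + (of t₁ - of u₁) + (of t₂ - of u₂) -
        (of t - of u₁ - of u₂) := by abel
    rw [e]
    exact relations.sub_mem
      (relations.add_mem (relations.add_mem (relations.add_mem hx hy) hu₁r) hu₂r) hadd

/-! ## A bounded volume is a bounded cube integrand -/

/-- **Cubification of a bounded volume.** If `V` is a representation in dimension `d` with bounded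
domain `σ ⊆ [−N, N]^d` and integrand `1` on it, then `[V] ≡ [[0,1]^d, (4N)^d · 𝟙_{Φ(σ)}]` modulo the
moves, where `Φ(z) = z/(4N) + 1/2`: one change of variables (rule (2): `Φ` is a `ℚ`-polynomial map,
injective, with derivative `(4N)⁻¹ • id` of absolute determinant `(4N)^{-d}`, and
`Φ(σ) ⊆ [1/4, 3/4]^d`), one domain-additivity move `[0,1]^d = Φ(σ) ∪ ([0,1]^d ∖ Φ(σ))` (rule (1a)),
and the discarding of the second piece, whose integrand vanishes (rule (1b)). The cube integrand is
bounded by `(4N)^d`. [cite: KontsevichZagier2001, §1.2 rule (2)] -/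
theorem cubify_volume {d : ℕ} (V : IntegralRep d) (hb : Bornology.IsBounded V.domain)
    (h1 : ∀ z ∈ V.domain, V.integrand z = 1) :
    ∃ (M : ℕ) (t : IntegralRep M),
      t.domain = Set.pi Set.univ (fun _ : Fin M => Set.Icc (0:ℝ) 1) ∧
      (∃ B : ℝ, ∀ z ∈ t.domain, |t.integrand z| ≤ B) ∧ of V - of t ∈ relations := by
  classical
  -- a box `[-N, N]^d`, `N ≥ 1`, containing the domain
  obtain ⟨r, hr⟩ := hb.subset_closedBall 0
  set N : ℕ := ⌈r⌉₊ + 1 with hN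
  have hN1 : (1 : ℝ) ≤ N := by rw [hN]; exact_mod_cast Nat.le_add_left 1 ⌈r⌉₊
  have hNpos : (0 : ℝ) < N := by linarith
  have hrN : r ≤ N := (Nat.le_ceil r).trans (by rw [hN]; exact_mod_cast Nat.le_succ ⌈r⌉₊)
  have hcoord : ∀ z ∈ V.domain, ∀ i, |z i| ≤ N := fun z hz i => by
    have hz' : ‖z‖ ≤ r := mem_closedBall_zero_iff.mp (hr hz)
    calc |z i| = ‖z i‖ := (Real.norm_eq_abs _).symm
      _ ≤ ‖z‖ := norm_le_pi_norm z i
      _ ≤ N := hz'.trans hrN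
  -- the contraction `Φ(z) = z/(4N) + 1/2`
  set s : ℝ := 1 / (4 * N) with hs
  have hspos : 0 < s := by rw [hs]; positivity
  have hsN : s * N = 1 / 4 := by rw [hs]; field_simp
  set Φ : (Fin d → ℝ) → (Fin d → ℝ) := fun z i => s * z i + 1 / 2 with hΦ
  have hΦcube : ∀ z ∈ V.domain, Φ z ∈ Set.pi Set.univ (fun _ : Fin d => Set.Icc (0:ℝ) 1) := by
    intro z hz i _
    have habs : |s * z i| ≤ 1 / 4 := by
      rw [abs_mul, abs_of_pos hspos, ← hsN]
      exact mul_le_mul_of_nonneg_left (hcoord z hz i) hspos.le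
    rw [abs_le] at habs
    simp only [hΦ, mem_Icc]
    constructor <;> linarith [habs.1, habs.2]
  have hsa : IsSemialgebraicMapOn ℚ V.domain Φ := by
    refine (isSemialgebraicMapOn_aeval V.isSemialgebraic_domain
      fun i => C ((1 : ℚ) / (4 * N)) * X i + C ((1 : ℚ) / 2)).congr fun z _ => ?_
    funext i
    simp only [hΦ, hs, map_add, map_mul, MvPolynomial.aeval_C, MvPolynomial.aeval_X, eq_ratCast]
    push_cast
    ring
  have hderiv : ∀ z, HasFDerivAt Φ (s • ContinuousLinearMap.id ℝ (Fin d → ℝ)) z := by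
    intro z
    have : Φ = fun y => (s • ContinuousLinearMap.id ℝ (Fin d → ℝ)) y + fun _ => (1 / 2 : ℝ) := by
      funext y i
      simp [hΦ, smul_eq_mul]
    rw [this]
    exact (s • ContinuousLinearMap.id ℝ (Fin d → ℝ)).hasFDerivAt.add_const _
  have hinj : InjOn Φ V.domain := by
    intro x _ y _ hxy
    funext i
    have h := congr_fun hxy i
    simp only [hΦ] at h
    exact mul_left_cancel₀ hspos.ne' (add_right_cancel h)
  have hdet : |(s • ContinuousLinearMap.id ℝ (Fin d → ℝ)).det| = s ^ d := by
    have : (s • ContinuousLinearMap.id ℝ (Fin d → ℝ)).det = s ^ d := by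
      change LinearMap.det ((s • ContinuousLinearMap.id ℝ (Fin d → ℝ) :
        (Fin d → ℝ) →L[ℝ] (Fin d → ℝ)) : (Fin d → ℝ) →ₗ[ℝ] (Fin d → ℝ)) = s ^ d
      rw [ContinuousLinearMap.toLinearMap_smul, ContinuousLinearMap.coe_id, LinearMap.det_smul,
        LinearMap.det_id, Module.finrank_fin_fun, mul_one]
    rw [this, abs_of_pos (pow_pos hspos d)]
  -- the image `T = Φ(σ) ⊆ [0,1]^d`
  set T : Set (Fin d → ℝ) := Φ '' V.domain with hT
  have hTsa : IsSemialgebraic ℚ T :=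
    IsSemialgebraicMapOn.isSemialgebraic_image_holds hsa subset_rfl V.isSemialgebraic_domain
  have hTsub : T ⊆ Set.pi Set.univ (fun _ : Fin d => Set.Icc (0:ℝ) 1) := by
    rintro _ ⟨z, hz, rfl⟩
    exact hΦcube z hz
  have hcube : IsSemialgebraic ℚ (Set.pi Set.univ (fun _ : Fin d => Set.Icc (0:ℝ) 1)) :=
    isSemialgebraic_cubePi d
  have hcubeb : Bornology.IsBounded (Set.pi Set.univ (fun _ : Fin d => Set.Icc (0:ℝ) 1)) :=
    (isCompact_univ_pi fun _ => isCompact_Icc).isBounded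
  have hTmeas : MeasurableSet T :=
    Literature.ModelTheory.ExponentialFields.IsSemialgebraic.measurableSet_holds hTsa
  have hcubefin : volume (Set.pi Set.univ (fun _ : Fin d => Set.Icc (0:ℝ) 1)) ≠ ⊤ :=
    hcubeb.measure_lt_top.ne
  -- the constant `c = (4N)^d = s^{-d}` and the cube integrand `c · 𝟙_T`
  set c : ℝ := (4 * N) ^ d with hc
  have hcs : c * s ^ d = 1 := by
    rw [hc, hs, ← mul_pow, mul_one_div_cancel (by positivity), one_pow]
  set g : (Fin d → ℝ) → ℝ := T.indicator fun _ => c with hg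
  have hgT : EqOn g (fun _ => c) T := fun z hz => by rw [hg, indicator_of_mem hz]
  have hgT' : EqOn g (fun _ => (0:ℝ)) (Set.pi Set.univ (fun _ : Fin d => Set.Icc (0:ℝ) 1) \ T) :=
    fun z hz => by rw [hg, indicator_of_notMem hz.2]
  have hg_sa : IsSemialgebraicFunOn ℚ (Set.pi Set.univ (fun _ : Fin d => Set.Icc (0:ℝ) 1)) g := by
    have h₁ : IsSemialgebraicFunOn ℚ T (fun _ => c) :=
      (isSemialgebraicFunOn_ratCast hTsa ((4 * N) ^ d : ℚ)).congr fun _ _ => by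
        rw [hc]; push_cast; rfl
    have h₂ : IsSemialgebraicFunOn ℚ (Set.pi Set.univ (fun _ : Fin d => Set.Icc (0:ℝ) 1) \ T)
        (fun _ => (0:ℝ)) :=
      (isSemialgebraicFunOn_ratCast (hcube.diff hTsa) 0).congr fun _ _ => by push_cast; rfl
    have h := h₁.union h₂ hgT hgT'
    rwa [Set.union_sdiff_cancel hTsub] at h
  have hg_int : IntegrableOn g (Set.pi Set.univ (fun _ : Fin d => Set.Icc (0:ℝ) 1)) := by
    rw [hg]
    exact (integrableOn_const hcubefin).indicator hTmeas
  let t : IntegralRep d :=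
    ⟨Set.pi Set.univ (fun _ : Fin d => Set.Icc (0:ℝ) 1), g, hcube, hg_sa, hg_int⟩
  -- its two pieces `[T, c]` and `[[0,1]^d ∖ T, 0]`
  let R₁ : IntegralRep d := t.restrict T hTsa hTsub
  let R₂ : IntegralRep d :=
    t.restrict (Set.pi Set.univ (fun _ : Fin d => Set.Icc (0:ℝ) 1) \ T) (hcube.diff hTsa) Set.sdiff_subset
  have e1 : of t - of R₁ - of R₂ ∈ relations := by
    refine domainAddRel_subset_relations ⟨d, t, R₁, R₂, ?_, ?_, fun _ _ => rfl, fun _ _ => rfl, rfl⟩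
    · show Set.pi Set.univ (fun _ : Fin d => Set.Icc (0:ℝ) 1) =
        T ∪ (Set.pi Set.univ (fun _ : Fin d => Set.Icc (0:ℝ) 1) \ T)
      exact (Set.union_sdiff_cancel hTsub).symm
    · show volume (T ∩ (Set.pi Set.univ (fun _ : Fin d => Set.Icc (0:ℝ) 1) \ T)) = 0
      rw [Set.inter_sdiff_self, measure_empty]
  have e2 : of R₂ ∈ relations := of_mem_relations_of_eqOn_zero R₂ fun z hz => hgT' hz
  have e3 : of V - of R₁ ∈ relations := by
    refine changeOfVariablesRel_subset_relations ⟨d, V, R₁, Φ,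
      fun _ => s • ContinuousLinearMap.id ℝ (Fin d → ℝ), hsa,
      fun z _ => (hderiv z).hasFDerivWithinAt, hinj, rfl, fun z hz => ?_, rfl⟩
    have hΦz : Φ z ∈ T := mem_image_of_mem Φ hz
    rw [h1 z hz, hdet]
    show (1:ℝ) = g (Φ z) * s ^ d
    rw [hgT hΦz, hcs]
  refine ⟨d, t, rfl, ⟨|c|, fun z _ => ?_⟩, ?_⟩
  · show |T.indicator (fun _ => c) z| ≤ |c|
    by_cases hz : z ∈ T
    · rw [indicator_of_mem hz]
    · rw [indicator_of_notMem hz, abs_zero]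
      exact abs_nonneg c
  · have e : of V - of t = (of V - of R₁) - (of t - of R₁ - of R₂) - of R₂ := by abel
    rw [e]
    exact relations.sub_mem (relations.sub_mem e3 e1) e2

/-! ## The stub -/

/-- **Registered stub `stub_cubifyKernel` (S1, one-cube normal form, resolution-free).** Every
formal `ℤ`-combination of integral representations is, modulo the moves of the Kontsevich–Zagier
calculus, ONE representation on a closed unit cube `[0,1]^M` with bounded integrand. Induction over
the free abelian group (`cubify_zero`, `cubify_neg`, `cubify_add`, `cubify_of_sub_mem`), the
generator case being Viu-Sos' reduction to two bounded volumes (`KZ.exists_sub_isBounded`) followed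
by `cubify_volume`. [cite: KontsevichZagier2001, §1.2] -/
theorem stub_cubifyKernel :
    ∀ x : FormalRep, ∃ (M : ℕ) (t : IntegralRep M),
      t.domain = Set.pi Set.univ (fun _ : Fin M => Set.Icc (0:ℝ) 1) ∧
      (∃ B : ℝ, ∀ z ∈ t.domain, |t.integrand z| ≤ B) ∧
      x - of t ∈ relations := by
  intro x
  induction x using FreeAbelianGroup.induction_on with
  | zero => exact cubify_zero
  | of p =>
    obtain ⟨n, r⟩ := p
    obtain ⟨A, B, hAb, hBb, hA1, hB1, e⟩ := exists_sub_isBounded r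
    have hAB := cubify_add (cubify_volume A hAb hA1) (cubify_neg (cubify_volume B hBb hB1))
    rw [← sub_eq_add_neg] at hAB
    exact cubify_of_sub_mem e hAB
  | neg p hp => exact cubify_neg hp
  | add x y hx hy => exact cubify_add hx hy

end Summit.KontsevichZagierPeriods.KontsevichZagierPeriods.Cruxes.StokesGeneration.FibrewiseStokes
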